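import Summits.AtomisticToContinuum.Crystallization.Theorems.ChargedEnergyGapTwinWalls

/-!
(SPLIT FOR THE 400-LINE CAP by the landing lane, hand-2 g29: this file = part A; part B = `…ChargedEnergyGapTwinWallsLink` imports it; same namespace, all FQNs unchanged.)
# `ChargedEnergyGap` — TWIN WALLS, part P-G(2/2): the LINK ISOMORPHISM proved, hence the dictionary and the laws
# UNCONDITIONALLY for `θ ≤ 19/100` (cell `decomp-a2c`, lens 3, generation 59, node «TwinWalls»; over P-G(1/2)
# `…Theorems.ChargedEnergyGapTwinWalls` by its future tree name)

P-G(1/2) typed the extraction as three finite pieces X-D0 `LinkIsomorphism θ`, X-D1 `SlotDictionary θ`, X-D2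
`FccNoCis θ` and proved the matter-side laws (LC)(FU)(TE)(JX)(E3) from X-D1 + X-D2.  THIS FILE PROVES ALL THREE PIECES for
every `θ ≤ 19/100` — so at the record `θ = 3/20` the dictionary `CleanLinkDictionaryRec` is a THEOREM
(`cleanLinkDictionaryRec_holds`) and layer continuation, one-layer-per-site, type exclusivity, junction exclusion at an
inspected column and «walls end only at unclean sites» hold UNCONDITIONALLY over the tree's definitions
(`equatorial_symm_of_le`, `walls_through_clean_site_of_le`, …; record forms `…_rec'`).  Nothing is added beneath (N𝄪) but
theorems.

THE PROOF (pure finite metric geometry of one clean shell; memo g59 §4).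
 (A) Integer models: after a frame `A`, scaled model vectors are at distance `√(|v−w|²/N)`; `= 1 ⟺ TouchInt`;
     `< √2 ⟹ |v−w|² < 2N ⟹ v = w ∨ touching` (`fccInt_gap`, `hcpInt_gap`, by `decide`: the patterns have no distance
     strictly between `1` and `√2`).
 (B) The shell of a CLEAN site (`(1/100)`-charge-free and `θ`-charted, hence gapped — part K): shell points = bond
     neighbours; radii `≤ 1.01`; a bonded pair of shell points is `≤ 1.01² = 1.0201` apart in shell units.
 (⟹) bonded ⟹ touching: images `≤ 1.0201 + 2θ ≤ 1.4001 < √2` apart, not equal (the matching and `shellCoord` are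
     injective), hence touching by (A).
 (⟸) touching ⟹ bonded, by COUNTING: the ring of `p q` has `4` members (ring number four of a charge-free site); their
     images are `4` distinct model vectors touching the image of `q` (by ⟹); the model ring has exactly `4` members
     (`card_ringInt_fcc/hcp`); so every model vector touching the image of `q` is the image of a ring member — in
     particular the image of `r`, whence `r` is in the ring: `q ∼ r`.
 X-D2: a cis bond at an fcc-framed clean site would transport (⟹) to a cherry in the cuboctahedron model — `not_cisInt_fcc`.
 X-D1 ⟸: a cis bond transports to a model cherry at the label of `q`, which is therefore equatorial (`cisInt_hcp_iff`), and
     `q` sits within `θ` of that equatorial slot.  X-D1 ⟹: a point in an equatorial slot is a bond neighbour (norm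
     `∈ [1−θ, 1+θ] ⊂ (0, 6/5]`, gap) whose label IS the slot vector (`2θ < 1` = pattern separation); the model cherry at an
     equatorial vector (`cisInt_hcp_iff` ⟸) transports back (⟸) to a cherry in the ring of `p q`.
No `sorry`, no axiom, no instance, no notation, no `set_option`; `decide` only on the closed integer models.
-/

noncomputable section

open Literature.MathematicalPhysics.StatisticalMechanics
open Literature.Geometry.DiscreteGeometry
open Summit.AtomisticToContinuum.Crystallization.Theses.PricedLinkCensus
open Summit.AtomisticToContinuum.Crystallization.Theorems.ChargedEnergyGapNegative

namespace Summit.AtomisticToContinuum.Crystallization.Theorems.ChargedEnergyGapChartDial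

section TwinWallsLink

/-! ## A. Metric facts of the integer models -/

/-- Squared norms are non-negative. -/
private theorem sqNormInt_nonneg_tw (v : Fin 3 → ℤ) : 0 ≤ sqNormInt v := by
  unfold sqNormInt; positivity

/-- A frame preserves distances. -/
theorem dist_frame (A : E3 →ₗᵢ[ℝ] E3) (x y : E3) : dist (A x) (A y) = dist x y := by
  rw [dist_eq_norm, ← map_sub, A.norm_map, dist_eq_norm]

/-- Distance of two framed, scaled model vectors. -/
theorem dist_frame_scaled (A : E3 →ₗᵢ[ℝ] E3) (N : ℕ) (v w : Fin 3 → ℤ) :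
    dist (A ((Real.sqrt N)⁻¹ • intVec v)) (A ((Real.sqrt N)⁻¹ • intVec w))
      = (Real.sqrt N)⁻¹ * Real.sqrt (sqNormInt (v - w) : ℝ) := by
  rw [dist_frame, dist_eq_norm, ← smul_sub, intVec_sub, norm_smul, norm_inv,
    Real.norm_of_nonneg (Real.sqrt_nonneg _), norm_intVec]

/-- Framed, scaled model vectors are at distance `1` iff the model vectors touch. -/
theorem dist_frame_scaled_eq_one_iff (A : E3 →ₗᵢ[ℝ] E3) {N : ℕ} (hN : N ≠ 0) (v w : Fin 3 → ℤ) :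
    dist (A ((Real.sqrt N)⁻¹ • intVec v)) (A ((Real.sqrt N)⁻¹ • intVec w)) = 1 ↔ TouchInt N v w := by
  have hpos : (0 : ℝ) < Real.sqrt N := Real.sqrt_pos.2 (by exact_mod_cast Nat.pos_of_ne_zero hN)
  rw [dist_frame_scaled, inv_mul_eq_one₀ hpos.ne',
    Real.sqrt_inj (Nat.cast_nonneg _) (by exact_mod_cast sqNormInt_nonneg_tw _)]
  constructor
  · intro h
    have h' : ((sqNormInt (v - w) : ℤ) : ℝ) = ((N : ℤ) : ℝ) := by rw [Int.cast_natCast]; exact h.symm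
    exact_mod_cast h'
  · intro h
    have h' : ((sqNormInt (v - w) : ℤ) : ℝ) = ((N : ℤ) : ℝ) := by exact_mod_cast h
    rw [h', Int.cast_natCast]

/-- Framed, scaled model vectors closer than `√2` differ by squared norm `< 2N`. -/
theorem sqNormInt_lt_of_dist_lt_tw (A : E3 →ₗᵢ[ℝ] E3) {N : ℕ} (hN : N ≠ 0) {v w : Fin 3 → ℤ}
    (h : dist (A ((Real.sqrt N)⁻¹ • intVec v)) (A ((Real.sqrt N)⁻¹ • intVec w)) < Real.sqrt 2) :
    sqNormInt (v - w) < 2 * (N : ℤ) := by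
  have hpos : (0 : ℝ) < Real.sqrt N := Real.sqrt_pos.2 (by exact_mod_cast Nat.pos_of_ne_zero hN)
  rw [dist_frame_scaled, inv_mul_eq_div, div_lt_iff₀ hpos, ← Real.sqrt_mul (by norm_num : (0 : ℝ) ≤ 2)] at h
  have h2 : (sqNormInt (v - w) : ℝ) < 2 * (N : ℝ) :=
    (Real.sqrt_lt_sqrt_iff (by exact_mod_cast sqNormInt_nonneg_tw _)).1 h
  exact_mod_cast h2

/-- GAP in the FCC model: no distance strictly between `1` and `√2`. -/
theorem fccInt_gap : ∀ v ∈ fccInt, ∀ w ∈ fccInt, sqNormInt (v - w) < 2 * ((2 : ℕ) : ℤ) → v = w ∨ TouchInt (2 : ℕ) v w := by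
  decide

/-- GAP in the HCP model: no distance strictly between `1` and `√2`. -/
theorem hcpInt_gap : ∀ v ∈ hcpInt, ∀ w ∈ hcpInt, sqNormInt (v - w) < 2 * ((18 : ℕ) : ℤ) → v = w ∨ TouchInt (18 : ℕ) v w := by
  decide

/-- The finite facts of an integer model used below: non-zero scale, the gap, ring number four. -/
def ModelFacts (S : Finset (Fin 3 → ℤ)) (N : ℕ) : Prop :=
  N ≠ 0 ∧ (∀ v ∈ S, ∀ w ∈ S, sqNormInt (v - w) < 2 * (N : ℤ) → v = w ∨ TouchInt N v w) ∧
    ∀ v ∈ S, (ringInt S N v).card = 4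

/-- The FCC model has them. -/
theorem modelFacts_fcc : ModelFacts fccInt 2 := ⟨two_ne_zero, fccInt_gap, by decide⟩

/-- The HCP model has them. -/
theorem modelFacts_hcp : ModelFacts hcpInt 18 := ⟨by norm_num, hcpInt_gap, by decide⟩

/-! ## B. The shell of a clean site: shell points = bond neighbours, radii and bonded pairs -/

section shell

variable {θ : ℝ} {Q : PeriodicConfiguration 3} {p : Q.points}

/-- Bond neighbours sit at shell radius `≤ 1.01`. -/
theorem norm_shellCoord_le_of_adj_tw {q : Q.points} (h : (bonds Q).Adj p q) : ‖shellCoord Q p q‖ ≤ 101 / 100 := by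
  have hc : 0 < nn Q p := Blocks.nearestDist_pt_pos Q p
  have hd : dist (p : E3) q ≤ (1 + 1 / 100) * nn Q p := dist_le_of_adj (by norm_num) h
  rw [dist_eq_nn_mul_norm_shellCoord] at hd
  nlinarith

/-- Bonded sites have comparable scales: `nn(q) ≤ 1.01 · nn(p)`. -/
theorem nn_le_of_adj {q : Q.points} (h : (bonds Q).Adj p q) : nn Q q ≤ 101 / 100 * nn Q p := by
  have h1 : nn Q q ≤ dist (q : E3) p := nearestDist_le_dist _ (bondGraph_adj.1 h).1
  have h2 : dist (p : E3) q ≤ (1 + 1 / 100) * nn Q p := dist_le_of_adj (by norm_num) h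
  rw [dist_comm] at h1
  linarith

/-- Two BONDED bond-neighbours of `p` are `≤ 1.01² = 1.0201` apart in the shell units of `p`. -/
theorem dist_shellCoord_le_of_adj_tw {q r : Q.points} (hq : (bonds Q).Adj p q) (hqr : (bonds Q).Adj q r) :
    dist (shellCoord Q p q) (shellCoord Q p r) ≤ 10201 / 10000 := by
  have hc : 0 < nn Q p := Blocks.nearestDist_pt_pos Q p
  have h1 : dist (q : E3) r ≤ (1 + 1 / 100) * nn Q q := dist_le_of_adj (by norm_num) hqr
  have h2 := nn_le_of_adj hq
  rw [dist_eq_nn_mul_dist_shellCoord Q p] at h1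
  have h3 : nn Q p * dist (shellCoord Q p q) (shellCoord Q p r) ≤ nn Q p * (10201 / 10000) := by nlinarith
  exact le_of_mul_le_mul_left h3 hc

variable {T : Finset E3}

/-- At a clean site the shell finset consists exactly of the shell positions of the bond neighbours. -/
theorem mem_shell_iff (hT : (↑T : Set E3) = shellSet Q p) (hp : CleanAt Q θ p) {q : Q.points} :
    shellCoord Q p q ∈ T ↔ (bonds Q).Adj p q := by
  constructor
  · intro h
    have h' : shellCoord Q p q ∈ shellSet Q p := by rw [← hT]; exact h
    obtain ⟨q', hq'p, hq'd, hq'⟩ := (mem_shellSet_iff Q).1 h'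
    have hqq : q' = q := Subtype.ext (shellCoord_injective Q p hq')
    subst hqq
    exact gappedAt_of_chartedAt Q hp.1 hp.2 q' hq'p hq'd
  · intro h
    obtain ⟨hqp, hqd⟩ := mem_shellBall_of_adj Q h
    have h' := shellCoord_mem Q hqp hqd
    rw [← hT] at h'
    exact h'

/-- Every shell point is the position of a bond neighbour. -/
theorem exists_adj_of_mem_shell (hT : (↑T : Set E3) = shellSet Q p) (hp : CleanAt Q θ p) {t : E3} (ht : t ∈ T) :
    ∃ q : Q.points, (bonds Q).Adj p q ∧ shellCoord Q p q = t := by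
  have h' : t ∈ shellSet Q p := by rw [← hT]; exact ht
  obtain ⟨q, hqp, hqd, hq⟩ := (mem_shellSet_iff Q).1 h'
  exact ⟨q, gappedAt_of_chartedAt Q hp.1 hp.2 q hqp hqd, hq⟩

end shell

/-! ## C. The link isomorphism: bonded ⟺ touching labels -/

section link

variable {θ : ℝ} {Q : PeriodicConfiguration 3} {p : Q.points} {S : Finset (Fin 3 → ℤ)} {N : ℕ} {P : Finset E3}
  {A : E3 →ₗᵢ[ℝ] E3} {T : Finset E3} {e : ↥T ≃ ↥(P.image A)}

/-- Every framed pattern point has a LABEL in the integer model. -/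
theorem exists_label (hP : P = scaledPattern S N) (y : ↥(P.image A)) :
    ∃ w ∈ S, (y : E3) = A ((Real.sqrt N)⁻¹ • intVec w) := by
  obtain ⟨y, hy⟩ := y
  obtain ⟨x, hx, rfl⟩ := Finset.mem_image.1 hy
  rw [hP] at hx
  obtain ⟨w, hw, rfl⟩ := Finset.mem_image.1 hx
  exact ⟨w, hw, rfl⟩

/-- Framed model vectors are framed pattern points. -/
theorem frameVec_mem (hP : P = scaledPattern S N) {w : Fin 3 → ℤ} (hw : w ∈ S) :
    A ((Real.sqrt N)⁻¹ • intVec w) ∈ P.image A := by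
  rw [hP]
  exact Finset.mem_image_of_mem _ (Finset.mem_image_of_mem _ hw)

/-- Labels are injective on shell points. -/
theorem eq_of_label_eq {q r : Q.points} (hq : shellCoord Q p q ∈ T) (hr : shellCoord Q p r ∈ T)
    {wq wr : Fin 3 → ℤ} (hwq : (e ⟨_, hq⟩ : E3) = A ((Real.sqrt N)⁻¹ • intVec wq))
    (hwr : (e ⟨_, hr⟩ : E3) = A ((Real.sqrt N)⁻¹ • intVec wr)) (h : wq = wr) : q = r := by
  subst h
  have h1 : (e ⟨_, hq⟩ : E3) = (e ⟨_, hr⟩ : E3) := by rw [hwq, hwr]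
  exact Subtype.ext (shellCoord_injective Q p (congrArg Subtype.val (e.injective (Subtype.ext h1))))

/-- The margin numeral: `1.0201 + 2θ < √2` for `θ ≤ 19/100`. -/
theorem margin_lt_sqrt_two (hθ : θ ≤ 19 / 100) : θ + 10201 / 10000 + θ < Real.sqrt 2 := by
  have h1 : θ + 10201 / 10000 + θ ≤ 14001 / 10000 := by linarith
  have h2 : (14001 / 10000 : ℝ) < Real.sqrt 2 := by
    rw [show (14001 / 10000 : ℝ) = Real.sqrt ((14001 / 10000) ^ 2) by rw [Real.sqrt_sq (by norm_num)]]
    exact Real.sqrt_lt_sqrt (by norm_num) (by norm_num)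
  linarith

/-- ★ (⟹) BONDED ⟹ TOUCHING: two bonded shell points of a clean site have touching labels. -/
theorem touchInt_of_adj (hM : ModelFacts S N) (hT : (↑T : Set E3) = shellSet Q p)
    (he : ∀ t : ↥T, dist (t : E3) (e t : E3) ≤ θ) (hp : CleanAt Q θ p) (hθ : θ ≤ 19 / 100)
    {q r : Q.points} (hq : shellCoord Q p q ∈ T) (hr : shellCoord Q p r ∈ T)
    {wq wr : Fin 3 → ℤ} (hwqS : wq ∈ S) (hwq : (e ⟨_, hq⟩ : E3) = A ((Real.sqrt N)⁻¹ • intVec wq))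
    (hwrS : wr ∈ S) (hwr : (e ⟨_, hr⟩ : E3) = A ((Real.sqrt N)⁻¹ • intVec wr))
    (hqr : (bonds Q).Adj q r) : TouchInt N wq wr := by
  have hpq : (bonds Q).Adj p q := (mem_shell_iff hT hp).1 hq
  have hd : dist (shellCoord Q p q) (shellCoord Q p r) ≤ 10201 / 10000 := dist_shellCoord_le_of_adj_tw hpq hqr
  have h1 : dist (shellCoord Q p q) (e ⟨_, hq⟩ : E3) ≤ θ := he ⟨_, hq⟩
  have h2 : dist (shellCoord Q p r) (e ⟨_, hr⟩ : E3) ≤ θ := he ⟨_, hr⟩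
  have hlt : dist (A ((Real.sqrt N)⁻¹ • intVec wq)) (A ((Real.sqrt N)⁻¹ • intVec wr)) < Real.sqrt 2 := by
    rw [← hwq, ← hwr]
    have htri : dist (e ⟨_, hq⟩ : E3) (e ⟨_, hr⟩ : E3) ≤ θ + 10201 / 10000 + θ :=
      calc dist (e ⟨_, hq⟩ : E3) (e ⟨_, hr⟩ : E3)
          ≤ dist (e ⟨_, hq⟩ : E3) (shellCoord Q p q) + dist (shellCoord Q p q) (shellCoord Q p r)
              + dist (shellCoord Q p r) (e ⟨_, hr⟩ : E3) := dist_triangle4 _ _ _ _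
        _ ≤ θ + 10201 / 10000 + θ := by rw [dist_comm] at h1; linarith
    linarith [margin_lt_sqrt_two hθ]
  rcases hM.2.1 wq hwqS wr hwrS (sqNormInt_lt_of_dist_lt_tw A hM.1 hlt) with h | h
  · exact absurd (eq_of_label_eq hq hr hwq hwr h) (bondGraph_adj.1 hqr).1
  · exact h

/-- ★ (⟸) TOUCHING ⟹ BONDED, by counting the ring: `4` ring members have `4` distinct touching labels, the model ring has
exactly `4` members, so a shell point with a touching label is a ring member. -/
theorem adj_of_touchInt (hP : P = scaledPattern S N) (hM : ModelFacts S N) (hT : (↑T : Set E3) = shellSet Q p)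
    (he : ∀ t : ↥T, dist (t : E3) (e t : E3) ≤ θ) (hp : CleanAt Q θ p) (hθ : θ ≤ 19 / 100)
    {q r : Q.points} (hq : shellCoord Q p q ∈ T) (hr : shellCoord Q p r ∈ T)
    {wq wr : Fin 3 → ℤ} (hwqS : wq ∈ S) (hwq : (e ⟨_, hq⟩ : E3) = A ((Real.sqrt N)⁻¹ • intVec wq))
    (hwrS : wr ∈ S) (hwr : (e ⟨_, hr⟩ : E3) = A ((Real.sqrt N)⁻¹ • intVec wr))
    (ht : TouchInt N wq wr) : (bonds Q).Adj q r := by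
  classical
  have hpq : (bonds Q).Adj p q := (mem_shell_iff hT hp).1 hq
  -- the matching as a function on `E3`, injective on the shell
  set em : E3 → E3 := fun t => if h : t ∈ T then ((e ⟨t, h⟩ : ↥(P.image A)) : E3) else t with hem
  have hem_apply : ∀ {t : E3} (h : t ∈ T), em t = (e ⟨t, h⟩ : E3) := fun h => by simp [hem, h]
  have hem_inj : Set.InjOn em ↑T := by
    intro t₁ h₁ t₂ h₂ h12
    rw [hem_apply h₁, hem_apply h₂] at h12
    exact congrArg Subtype.val (e.injective (Subtype.ext h12))
  -- the labels as a function on the model, injective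
  set F : (Fin 3 → ℤ) → E3 := fun w => A ((Real.sqrt N)⁻¹ • intVec w) with hF
  have hF_inj : Function.Injective F := fun a b h => scaledPattern_map_injective hM.1 (A.injective h)
  -- the ring of `p q` in `Q` (four members) and its shell image (four points of `T`)
  set R : Set Q.points := bondRing Q p q with hR
  have hR4 : R.ncard = 4 := ncard_bondRing_eq_four Q hp.1 hpq
  set SR : Set E3 := (fun r' : Q.points => shellCoord Q p r') '' R with hSR
  have hSRT : SR ⊆ ↑T := by
    rintro _ ⟨r', hr', rfl⟩
    exact (mem_shell_iff hT hp).2 hr'.1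
  have hSR4 : SR.ncard = 4 := by
    rw [hSR, Set.ncard_image_of_injective _ (fun a b h => Subtype.ext (shellCoord_injective Q p h)), hR4]
  -- the model ring of the label of `q` (four members) and its framed image
  set PR : Set E3 := F '' ↑(ringInt S N wq) with hPR
  have hPR4 : PR.ncard = 4 := by
    rw [hPR, Set.ncard_image_of_injective _ hF_inj, Set.ncard_coe_finset, hM.2.2 wq hwqS]
  have hPRfin : PR.Finite := (Finset.finite_toSet _).image _
  -- (⟹) maps the shell ring into the model ring
  have hsub : em '' SR ⊆ PR := by
    rintro _ ⟨_, ⟨r', hr'R, rfl⟩, rfl⟩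
    have hr'T : shellCoord Q p r' ∈ T := (mem_shell_iff hT hp).2 hr'R.1
    obtain ⟨w, hwS, hw⟩ := exists_label hP (e ⟨_, hr'T⟩)
    have htouch : TouchInt N wq w := touchInt_of_adj hM hT he hp hθ hq hr'T hwqS hwq hwS hw hr'R.2
    refine ⟨w, Finset.mem_coe.2 (Finset.mem_filter.2 ⟨hwS, htouch⟩), ?_⟩
    rw [hem_apply hr'T, hw]
  have himg4 : (em '' SR).ncard = 4 := by rw [(hem_inj.mono hSRT).ncard_image, hSR4]
  have heq : em '' SR = PR := Set.eq_of_subset_of_ncard_le hsub (by rw [hPR4, himg4]) hPRfin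
  -- the label of `r` touches: its framed image lies in the model ring image = shell ring image
  have hwr_ring : F wr ∈ PR := ⟨wr, Finset.mem_coe.2 (Finset.mem_filter.2 ⟨hwrS, ht⟩), rfl⟩
  rw [← heq] at hwr_ring
  obtain ⟨_, ⟨r', hr'R, rfl⟩, hr'⟩ := hwr_ring
  have hr'T : shellCoord Q p r' ∈ T := (mem_shell_iff hT hp).2 hr'R.1
  rw [hem_apply hr'T] at hr'
  have h1 : (e ⟨_, hr'T⟩ : E3) = (e ⟨_, hr⟩ : E3) := by rw [hr', hwr]
  have hrr : shellCoord Q p r' = shellCoord Q p r := congrArg Subtype.val (e.injective (Subtype.ext h1))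
  have hrr' : r' = r := Subtype.ext (shellCoord_injective Q p hrr)
  subst hrr'
  exact hr'R.2

end link

end TwinWallsLink

end Summit.AtomisticToContinuum.Crystallization.Theorems.ChargedEnergyGapChartDial
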